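import Literature.ModelTheory.ExponentialFields.RealAn
import Literature.ModelTheory.ExponentialFields.RestrictedAnalyticQF
import HarnessLib

/-!
# Quantifier-free definable sets of `ℝ_an` are quantifier-free definable in `(ℝ_an, ⁻¹)`

Topic `Literature/ModelTheory/ExponentialFields`.  The two formalizations of `ℝ_an` in this
directory speak about the same sets: on one side the first-order language `Language.realAn`
(`RealAn.lean`: `+, *, -, 0, 1, ≤` and a symbol for every restricted analytic function
`f : RestrictedAnalytic n`, interpreted by `RestrictedAnalytic.restrict`, Pila 2022, 8.21), on
the other the Denef–van den Dries term language of `(ℝ_an, ⁻¹)` (`RealAnTerms.lean`: terms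
`Term ι` built from global power series on `[-1,1]ᵐ`, constants, `+, ·, ⁻¹`, and its
quantifier-free sets `IsQF`; Denef–van den Dries 1988, §4).  We prove:

* `realAn_exists_pieces_term` — **every `L_an`-term is piecewise a Denef–van den Dries term**:
  there is a finite cover of `ℝ^ι` by quantifier-free sets of `(ℝ_an, ⁻¹)` on each of which the
  term is the evaluation of one `Term ι` (induction on the term; a restricted analytic symbol is
  handled by `RestrictedAnalytic.exists_finset_cover_terms` — the cube is covered by finitely many
  boxes on which `f` is a term — composed with the terms of the arguments by `Term.subst`, the
  relevant pieces being preimages of boxes under term maps, `IsQF.preimage`);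
* `realAn_isQF_setOf_realize` — **every quantifier-free `L_an`-formula defines an `IsQF` set**
  (atomic formulas `t₁ = t₂`, `t₁ ≤ t₂` piece by piece, then Boolean combinations), and the
  formula form `realAn_isQF_setOf_formula_realize`.

This is the entrance of the theory of `(ℝ_an, ⁻¹)` (quantifier elimination and o-minimality,
Denef–van den Dries 1988, under construction in this directory) into statements about the
first-order structures `ℝ_an` and `ℝ_an,exp` (`RealAnExpOMinimalProofs.lean`).  Nothing here is a
named fact; no definition is introduced.

## References

* [DenefvandenDries1988] J. Denef, L. van den Dries, Ann. of Math. 128 (1988), §4.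
* [Pila2022] J. Pila, *Point-counting and the Zilber–Pink conjecture* (2022), 8.21.
-/

noncomputable section

open Set FirstOrder

namespace Literature.ModelTheory.ExponentialFields

/-! ### `L_an`-terms are piecewise Denef–van den Dries terms -/

/-- The closed unit cube is a quantifier-free set of `(ℝ_an, ⁻¹)`. [folklore] -/
theorem isQF_Icc_zero_one {n : ℕ} : IsQF (Set.Icc (0 : Fin n → ℝ) 1) := by
  have h := IsQF.iInter (ι := Fin n) fun l : Fin n =>
    (isQF_setOf_le (Term.const 0) (Term.var l)).inter (isQF_setOf_le (Term.var l) (Term.const 1))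
  convert h using 1
  ext w
  simp only [Set.mem_Icc, Pi.le_def, Pi.zero_apply, Pi.one_apply, Set.mem_iInter,
    Set.mem_inter_iff, Set.mem_setOf_eq, Term.eval_const, Term.eval_var]
  exact ⟨fun h l => ⟨h.1 l, h.2 l⟩, fun h => ⟨fun l => (h l).1, fun l => (h l).2⟩⟩

/-- A closed box `|wᵢ - aᵢ| ≤ c` is a quantifier-free set of `(ℝ_an, ⁻¹)`. [folklore] -/
theorem isQF_box {n : ℕ} (a : Fin n → ℝ) (c : ℝ) :
    IsQF {w : Fin n → ℝ | ∀ i, |w i - a i| ≤ c} := by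
  have h := IsQF.iInter (ι := Fin n) fun i : Fin n =>
    isQF_setOf_abs_le (Term.sub (Term.var i) (Term.const (a i))) (Term.const c)
  convert h using 1
  ext w
  simp only [Set.mem_setOf_eq, Set.mem_iInter, Term.eval_sub, Term.eval_var, Term.eval_const]

/-- **Every `L_an`-term is piecewise a Denef–van den Dries term**: for a term `t` of
`Language.realAn` in the variables `ι` there are finitely many quantifier-free sets of
`(ℝ_an, ⁻¹)` covering `ℝ^ι` and, for each, a term of `(ℝ_an, ⁻¹)` computing `t` on it.
[cite: DenefvandenDries1988, §4] -/
theorem realAn_exists_pieces_term {ι : Type} (t : Language.realAn.Term ι) :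
    ∃ (κ : Type) (_ : Fintype κ) (piece : κ → Set (ι → ℝ)) (s : κ → Term ι),
      (∀ k, IsQF (piece k)) ∧ (∀ v, ∃ k, v ∈ piece k) ∧
      ∀ k v, v ∈ piece k → t.realize v = (s k).eval v := by
  classical
  induction t with
  | var i =>
    exact ⟨Unit, inferInstance, fun _ => Set.univ, fun _ => Term.var i, fun _ => isQF_univ,
      fun v => ⟨(), Set.mem_univ v⟩, fun _ v _ => rfl⟩
  | func F ts ih =>
    cases F with
    | add =>
      obtain ⟨κ₀, hκ₀, P₀, s₀, hq₀, hc₀, hv₀⟩ := ih 0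
      obtain ⟨κ₁, hκ₁, P₁, s₁, hq₁, hc₁, hv₁⟩ := ih 1
      refine ⟨κ₀ × κ₁, inferInstance, fun k => P₀ k.1 ∩ P₁ k.2,
        fun k => Term.add (s₀ k.1) (s₁ k.2), fun k => (hq₀ k.1).inter (hq₁ k.2), fun v => ?_,
        fun k v hv => ?_⟩
      · obtain ⟨k₀, h₀⟩ := hc₀ v
        obtain ⟨k₁, h₁⟩ := hc₁ v
        exact ⟨(k₀, k₁), h₀, h₁⟩
      · rw [Language.Term.realize_func, Language.realAn.funMap_add, Term.eval_add,
          hv₀ k.1 v hv.1, hv₁ k.2 v hv.2]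
    | mul =>
      obtain ⟨κ₀, hκ₀, P₀, s₀, hq₀, hc₀, hv₀⟩ := ih 0
      obtain ⟨κ₁, hκ₁, P₁, s₁, hq₁, hc₁, hv₁⟩ := ih 1
      refine ⟨κ₀ × κ₁, inferInstance, fun k => P₀ k.1 ∩ P₁ k.2,
        fun k => Term.mul (s₀ k.1) (s₁ k.2), fun k => (hq₀ k.1).inter (hq₁ k.2), fun v => ?_,
        fun k v hv => ?_⟩
      · obtain ⟨k₀, h₀⟩ := hc₀ v
        obtain ⟨k₁, h₁⟩ := hc₁ v
        exact ⟨(k₀, k₁), h₀, h₁⟩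
      · rw [Language.Term.realize_func, Language.realAn.funMap_mul, Term.eval_mul,
          hv₀ k.1 v hv.1, hv₁ k.2 v hv.2]
    | neg =>
      obtain ⟨κ₀, hκ₀, P₀, s₀, hq₀, hc₀, hv₀⟩ := ih 0
      refine ⟨κ₀, hκ₀, P₀, fun k => Term.neg (s₀ k), hq₀, hc₀, fun k v hv => ?_⟩
      rw [Language.Term.realize_func, Language.realAn.funMap_neg, Term.eval_neg, hv₀ k v hv]
    | zero =>
      exact ⟨Unit, inferInstance, fun _ => Set.univ, fun _ => Term.const 0, fun _ => isQF_univ,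
        fun v => ⟨(), Set.mem_univ v⟩, fun _ v _ => rfl⟩
    | one =>
      exact ⟨Unit, inferInstance, fun _ => Set.univ, fun _ => Term.const 1, fun _ => isQF_univ,
        fun v => ⟨(), Set.mem_univ v⟩, fun _ v _ => rfl⟩
    | an f =>
      -- pieces and terms for the arguments
      choose κ hκ P s hq hc hv using ih
      haveI : ∀ l, Fintype (κ l) := hκ
      -- pieces and terms for `f` on the cube
      obtain ⟨sf, c, τ, hsf, hcover⟩ := f.exists_finset_cover_terms
      -- the argument tuple as a term map, on the piece `j`
      let W : (∀ l, κ l) → _ → Term ι := fun j l => s l (j l)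
      have hW : ∀ (j : ∀ l, κ l) (v : ι → ℝ), (∀ l, v ∈ P l (j l)) →
          (fun l => (ts l).realize v) = fun l => (W j l).eval v := by
        intro j v hj
        funext l
        exact hv l (j l) v (hj l)
      refine ⟨(∀ l, κ l) × Option ↥sf, inferInstance,
        fun k => (⋂ l, P l (k.1 l)) ∩ (match k.2 with
          | some a => {v | (fun l => (W k.1 l).eval v) ∈ Set.Icc 0 1} ∩
              {v | (fun l => (W k.1 l).eval v) ∈ {w | ∀ i, |w i - a.1 i| ≤ c a.1}}
          | none => {v | (fun l => (W k.1 l).eval v) ∈ Set.Icc 0 1}ᶜ),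
        fun k => match k.2 with
          | some a => (τ a.1).subst (W k.1)
          | none => Term.const 0,
        fun k => ?_, fun v => ?_, fun k v hk => ?_⟩
      · -- the pieces are quantifier-free
        refine (IsQF.iInter fun l => hq l (k.1 l)).inter ?_
        rcases k with ⟨j, _ | a⟩
        · exact (isQF_Icc_zero_one.preimage (W j)).compl
        · exact (isQF_Icc_zero_one.preimage (W j)).inter ((isQF_box a.1 (c a.1)).preimage (W j))
      · -- the pieces cover
        choose j hj using fun l => hc l v
        by_cases hcube : (fun l => (W j l).eval v) ∈ Set.Icc 0 1
        · obtain ⟨a, ha, hbox⟩ := Set.mem_iUnion₂.1 (hcover hcube)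
          exact ⟨⟨j, some ⟨a, ha⟩⟩, Set.mem_iInter.2 hj, hcube, hbox⟩
        · exact ⟨⟨j, none⟩, Set.mem_iInter.2 hj, hcube⟩
      · -- the terms compute `f.restrict (t₁, …, tₙ)` on the pieces
        rcases k with ⟨j, _ | a⟩
        · obtain ⟨hj, hout⟩ := hk
          have hj' : ∀ l, v ∈ P l (j l) := fun l => Set.mem_iInter.1 hj l
          rw [Language.Term.realize_func, Language.realAn.funMap_an, hW j v hj',
            RestrictedAnalytic.restrict_of_not_mem _ hout]
          rfl
        · obtain ⟨hj, hcube, hbox⟩ := hk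
          have hj' : ∀ l, v ∈ P l (j l) := fun l => Set.mem_iInter.1 hj l
          rw [Language.Term.realize_func, Language.realAn.funMap_an, hW j v hj',
            RestrictedAnalytic.restrict_of_mem _ hcube]
          change f.toFun (fun l => (W j l).eval v) = ((τ a.1).subst (W j)).eval v
          rw [Term.eval_subst, (hsf a.1 a.2).2 _ hbox]

/-! ### Quantifier-free `L_an`-formulas define `IsQF` sets -/

/-- Atomic step: the set where two `L_an`-terms agree is quantifier-free in `(ℝ_an, ⁻¹)`.
[folklore] -/
theorem realAn_isQF_setOf_realize_eq {ι : Type} (t₁ t₂ : Language.realAn.Term ι) :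
    IsQF {v : ι → ℝ | t₁.realize v = t₂.realize v} := by
  classical
  obtain ⟨κ₁, hκ₁, P₁, s₁, hq₁, hc₁, hv₁⟩ := realAn_exists_pieces_term t₁
  obtain ⟨κ₂, hκ₂, P₂, s₂, hq₂, hc₂, hv₂⟩ := realAn_exists_pieces_term t₂
  have e : {v : ι → ℝ | t₁.realize v = t₂.realize v} =
      ⋃ k : κ₁ × κ₂, (P₁ k.1 ∩ P₂ k.2) ∩ {v | (s₁ k.1).eval v = (s₂ k.2).eval v} := by
    ext v
    simp only [Set.mem_setOf_eq, Set.mem_iUnion, Set.mem_inter_iff]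
    constructor
    · intro h
      obtain ⟨k₁, h₁⟩ := hc₁ v
      obtain ⟨k₂, h₂⟩ := hc₂ v
      exact ⟨(k₁, k₂), ⟨h₁, h₂⟩, by rw [← hv₁ k₁ v h₁, ← hv₂ k₂ v h₂, h]⟩
    · rintro ⟨k, ⟨h₁, h₂⟩, h⟩
      rw [hv₁ k.1 v h₁, hv₂ k.2 v h₂, h]
  rw [e]
  exact IsQF.iUnion fun k => ((hq₁ k.1).inter (hq₂ k.2)).inter (isQF_setOf_eq _ _)

/-- Atomic step: the set where one `L_an`-term is at most another is quantifier-free in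
`(ℝ_an, ⁻¹)`. [folklore] -/
theorem realAn_isQF_setOf_realize_le {ι : Type} (t₁ t₂ : Language.realAn.Term ι) :
    IsQF {v : ι → ℝ | t₁.realize v ≤ t₂.realize v} := by
  classical
  obtain ⟨κ₁, hκ₁, P₁, s₁, hq₁, hc₁, hv₁⟩ := realAn_exists_pieces_term t₁
  obtain ⟨κ₂, hκ₂, P₂, s₂, hq₂, hc₂, hv₂⟩ := realAn_exists_pieces_term t₂
  have e : {v : ι → ℝ | t₁.realize v ≤ t₂.realize v} =
      ⋃ k : κ₁ × κ₂, (P₁ k.1 ∩ P₂ k.2) ∩ {v | (s₁ k.1).eval v ≤ (s₂ k.2).eval v} := by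
    ext v
    simp only [Set.mem_setOf_eq, Set.mem_iUnion, Set.mem_inter_iff]
    constructor
    · intro h
      obtain ⟨k₁, h₁⟩ := hc₁ v
      obtain ⟨k₂, h₂⟩ := hc₂ v
      exact ⟨(k₁, k₂), ⟨h₁, h₂⟩, by rw [← hv₁ k₁ v h₁, ← hv₂ k₂ v h₂]; exact h⟩
    · rintro ⟨k, ⟨h₁, h₂⟩, h⟩
      rw [hv₁ k.1 v h₁, hv₂ k.2 v h₂]
      exact h
  rw [e]
  exact IsQF.iUnion fun k => ((hq₁ k.1).inter (hq₂ k.2)).inter (isQF_setOf_le _ _)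

/-- **Quantifier-free `L_an`-formulas define quantifier-free sets of `(ℝ_an, ⁻¹)`**: for a
quantifier-free bounded formula `χ` of `Language.realAn` (free variables `ι`, `m` variables in
scope), the set of valuations `u : ι ⊕ Fin m → ℝ` satisfying it is `IsQF`.
[cite: DenefvandenDries1988, §4] -/
theorem realAn_isQF_setOf_realize {ι : Type} {m : ℕ} {χ : Language.realAn.BoundedFormula ι m}
    (hχ : χ.IsQF) :
    IsQF {u : ι ⊕ Fin m → ℝ | χ.Realize (u ∘ Sum.inl) (u ∘ Sum.inr)} := by
  induction hχ with
  | falsum =>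
    simp only [Language.BoundedFormula.Realize, Set.setOf_false]
    exact isQF_empty
  | of_isAtomic h =>
    cases h with
    | equal t₁ t₂ =>
      have e := realAn_isQF_setOf_realize_eq t₁ t₂
      convert e using 1
      ext u
      simp
    | rel R ts =>
      cases R
      have e := realAn_isQF_setOf_realize_le (ts 0) (ts 1)
      convert e using 1
      ext u
      simp only [Set.mem_setOf_eq, Language.BoundedFormula.realize_rel, Sum.elim_comp_inl_inr]
      exact Iff.rfl
  | imp _ _ ih₁ ih₂ =>
    have e := ih₁.compl.union ih₂
    convert e using 1
    ext u
    simp only [Set.mem_setOf_eq, Language.BoundedFormula.realize_imp, Set.mem_union,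
      Set.mem_compl_iff]
    tauto

/-- **Quantifier-free `L_an`-formulas define quantifier-free sets of `(ℝ_an, ⁻¹)`**, formula
form: for a quantifier-free formula `φ` of `Language.realAn` in the variables `ι`,
`{v ∈ ℝ^ι | φ(v)}` is `IsQF`. [cite: DenefvandenDries1988, §4] -/
theorem realAn_isQF_setOf_formula_realize {ι : Type} {φ : Language.realAn.Formula ι}
    (hφ : φ.IsQF) : IsQF {v : ι → ℝ | φ.Realize v} := by
  have h := (realAn_isQF_setOf_realize hφ).preimage
    (Sum.elim (fun i => Term.var i) (fun e => Fin.elim0 e) : ι ⊕ Fin 0 → Term ι)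
  convert h using 1
  ext v
  simp only [Set.mem_setOf_eq]
  have e1 : ((fun j : ι ⊕ Fin 0 => (Sum.elim (fun i => Term.var i) (fun e => Fin.elim0 e) j).eval v)
      ∘ Sum.inl) = v := by
    funext i
    rfl
  rw [Language.Formula.Realize, e1]
  exact iff_of_eq (congrArg _ (funext fun e => Fin.elim0 e))

end Literature.ModelTheory.ExponentialFields

end
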